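import Summits.ABC.IUTFork.Cor312LicenceTripleHullCellRefuteTameSharp
import Summits.ABC.IUTFork.Cor312LicenceTripleHullCellRefute
import Summits.ABC.IUTFork.Conditional.RefBandsExactCellLinear
import Summits.ABC.IUTFork.Conditional.AbcOfSGenuineKTameRobustRows2
import HarnessLib

/-!
# R-W «W:REF-BANDS-EXACT», PER-TYPE band (TYPE-SPLIT pole): the triple `7 ^ 5 * 61 + 2 ^ 13 * 13 ^ 7 * 17 ^ 3 * 4229 ^ 3 = 3 ^ 13 * 5 ^ 8 * 11 ^ 3 * 53 * 73 ^ 2 * 89 ^ 2 * 103` — S_H REFUTED at EVERY genuine Θ-volume datum over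
# `(ratPoint (a/c), l)` whose fibre over `p = 4229` has the LOWER local type `e ∣ 5·l`, for EVERY prime `9 ≤ l ≤ 1681`, `l ≠ 4229`

PROOF-ONLY file (D-0012: 0 definitions, 0 `Prop` facts, no instance, no notation) of the abc-iut cell — D-0079 RESCUE sub-cell R-W «WINDOW Θ-SIDE
INEQUALITY», numerics-crew seat abc-iut-W-num-6 (gen 4), row «W:REF-BANDS-EXACT» (abc-iut-plan g11 C-R84 (b) / C-R88 (a)), answering the R-W numerics lead's
ROUTING MAP HOME/plan/rescue/R-W/TS-BANDS.tsv c7a7f5743650f576 (2026-08-27T05:21:49Z): at the TYPE-SPLIT pole `p = 4229` (`p ∣ ab`, `v = v_p(abc) = 3` odd or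
`3/5`-divisible, kernel class `{5, 10}` by abc-iut-W-neg-1 g4's `WRow.localType_class_triple_sharp`) the ∀T band of this seat's
`Conditional/RefBandsExact1025227.lean` stops where the UPPER member's certificate stops, while the LOWER member `A = 5` stays refuted much longer. GENERATED by
HOME/abc-iut-W-num-6/refbands/emit_typeband.py (closed form of CLOSED-FORMS.tsv / BAND-PLAN.tsv; member `A = 5` pieces: a₀ = 0 on [9,845] («-21130·l < -181804», (α,β) = (5,-19)), a₀ = 1 on [846,1681] («21150·l < 35570164», (α,β) = (-5,4204)); end 1681).
Shape of abc-iut-w5-d009 g14's «W:GAP-1019» per-type theorems (`WRowFrey37569208117Gap1657`, p497503), uniform in `l`: the sub-class hypothesis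
`hloc : ∀ x₀ ∣ 4229, e(K_x₀/ℚ_4229) ∣ 5·l` is sharpened to `e = 5·l` by the class lemma, and w5-d009's PINNED socket
`WRow.not_licence_triple_of_not_hullCell` (`Cor312LicenceTripleHullCellRefute`, p493429) fires with this seat's linear cells `RefBand.not_hullCell_of_linear'` (p496042).
* `RefBand.typecells_1025227_five` — the pinned socket's integer inputs for `A = 5` (turning point, failing top-label cell), piecewise linear;
* `WRow.not_licence_triple_1025227_typeband_of_five` — licence shape (every analytic `logv`, every realising idele pair);
* **`GenuineK.not_pilotKummerCompatHull_chosen_triple_1025227_typeband_of_five`** — the W-lane row shape (chosen ideles, pinned reading, every free binder).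
HONEST SCOPE: a PER-TYPE statement — it binds the local type at `p = 4229` (the other member of the class is NOT refuted on this range by this route; the R-W
lead's desk reads it INHABITED there as typed); SHARP reading; per-label licence STRONGER than print; admissibility / Szpiro-badness / (P6) and non-emptiness of the
datum type (and of the sub-class) NOT claimed; «refuted as typed» ≠ «refuted in print»; nothing about the number-level `Cor22.Cor312AtDatum`; typed ≠ proved;
no abc claim. [cite: Mochizuki2012, IUTchI Ex. 3.2 (iv) p. 71; IUTchIII Cor. 3.12 Step (xi-f) p. 184; IUTchIV Prop. 1.1 p. 9, Prop. 1.2 (i)(ii) p. 10, Cor. 2.2 (ii) proof (P5) p. 46]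
[cite: DupuyHilado2025, §3.4, §4.9, §4.12] [cite: SerreLocalFields1979, Ch. III §6 Prop. 13] [claim: Mochizuki2012, status: disputed] for every IUT sentence quoted.
-/

noncomputable section

open Set Function NumberField IsDedekindDomain

namespace Summit.ABC.IUTFork.Conditional

open Thm311 Thm311.Real Cor312 Cor312Vol Cor312Prov Literature.IUT.LogThetaLattice Literature.IUT.LogVolume
  Literature.IUT.HodgeTheaters Literature.IUT.LogVolume.ThetaData Literature.IUT.LogVolume.Cor22
open Literature.NumberTheory.NumberFields Literature.NumberTheory.GaloisRepresentations.Ultrametric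
open Literature.NumberTheory.DiophantineGeometry Literature.NumberTheory.DiophantineGeometry.GenEll Summit.ABC.ABC.Theorems
open Summit.ABC.IUTFork.Repair.RH.HullThresholdExact Summit.ABC.IUTFork.Repair.RH.HullThresholdExactRefute


/-- **The pinned socket's integer inputs for the member `A = 5` (pole `p = 4229`, `v = 3`), every odd `9 ≤ l ≤ 1681`, top label `i + 1 = l⋆`:**
turning point `a₀` and the failing top-label cell, piece by piece, by `RefBand.not_hullCell_of_linear'`. [folklore] -/
theorem RefBand.typecells_1025227_five {l : ℕ} (hlo : 9 ≤ l) (hhi : l ≤ 1681) (hodd : Odd l) {i : ℕ} (hi : i + 1 = (l - 1) / 2) :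
    ∃ a₀ : ℕ, (∀ s : ℕ, s < a₀ → (1 : ℤ) * ((4229 : ℕ) : ℤ) ^ s * (((4229 : ℕ) : ℤ) - 1) < ((5 * l : ℕ) : ℤ)) ∧
      ((5 * l : ℕ) : ℤ) ≤ 1 * ((4229 : ℕ) : ℤ) ^ a₀ * (((4229 : ℕ) : ℤ) - 1) ∧
      ¬ HullCell ((5 * l : ℕ) : ℤ) ((5 * 3 : ℕ) : ℤ) ((i : ℤ) + 1) (((5 * l) / ((4229 : ℕ) - 1) + 1 : ℕ) : ℤ)
        (((4229 : ℕ) : ℤ) ^ a₀ - (a₀ : ℤ) * ((5 * l : ℕ) : ℤ)) := by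
  obtain ⟨j, hj⟩ := hodd
  have hij : (i : ℤ) + 1 = (j : ℤ) := by
    have : i + 1 = j := by omega
    exact_mod_cast this
  have hlj : (l : ℤ) = 2 * (j : ℤ) + 1 := by exact_mod_cast hj
  have hcast : (((5 * l) / ((4229 : ℕ) - 1) + 1 : ℕ) : ℤ) = (5 : ℤ) * (l : ℤ) / ((4229 : ℤ) - 1) + 1 := by
    push_cast [Int.natCast_div]
    norm_num
  by_cases h0 : l ≤ 845
  · refine ⟨0, fun s hs => absurd hs (Nat.not_lt_zero s), ?_, ?_⟩
    · push_cast; omega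
    · rw [hij, hcast]
      have h := RefBand.not_hullCell_of_linear' (ev := 5) (v := 3) (p := 4229) (a := 0) (pa := 1) (l := (l : ℤ)) (j := (j : ℤ))
        (e := ((5 * l : ℕ) : ℤ)) (m := ((5 * 3 : ℕ) : ℤ)) (by norm_num) (by norm_num) (by positivity) hlj (by push_cast; ring)
        (by norm_num) (by push_cast; omega)
      simpa using h
  · have h0' : 845 < l := by omega
    refine ⟨1, fun s hs => ?_, ?_, ?_⟩
    · interval_cases s; push_cast; omega
    · push_cast; omega
    · rw [hij, hcast]
      have h := RefBand.not_hullCell_of_linear' (ev := 5) (v := 3) (p := 4229) (a := 1) (pa := 4229) (l := (l : ℤ)) (j := (j : ℤ))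
        (e := ((5 * l : ℕ) : ℤ)) (m := ((5 * 3 : ℕ) : ℤ)) (by norm_num) (by norm_num) (by positivity) hlj (by push_cast; ring)
        (by norm_num) (by push_cast; omega)
      simpa using h

/-- **PER-TYPE REF band, licence shape: the triple `7 ^ 5 * 61 + 2 ^ 13 * 13 ^ 7 * 17 ^ 3 * 4229 ^ 3 = 3 ^ 13 * 5 ^ 8 * 11 ^ 3 * 53 * 73 ^ 2 * 89 ^ 2 * 103`, sub-class `e(·∣4229) ∣ 5·l`, every prime `9 ≤ l ≤ 1681`, `l ≠ 4229`.**
For every such `l`, EVERY genuine Θ-volume datum `T` over `(ratPoint (a/c), l)` whose fibre points over `4229` have `e(K_x₀/ℚ_4229) ∣ 5·l`, every analytic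
`logv` and every pair of realising Θ- and q-ideles: `¬ Thm311ToCor312.Licence (settingPrVolSharp (pilotDataOfK T.D T.K) …)`. The class lemma makes `e = 5·l`
exact; `P_q = 15`; the integer inputs are `RefBand.typecells_1025227_five`.
[cite: Mochizuki2012, IUTchIII Cor. 3.12 Step (xi-f) p. 184; IUTchIV Prop. 1.1 p. 9, Prop. 1.2 (i)(ii) p. 10] [claim: Mochizuki2012, status: disputed] -/
theorem WRow.not_licence_triple_1025227_typeband_of_five {l : ℕ} (hl : l.Prime) (hlo : 9 ≤ l) (hhi : l ≤ 1681) (hne : l ≠ 4229)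
    (T : Cor22.ThetaVolumeDatumAt (ratPoint (((7 ^ 5 * 61 : ℕ) : ℚ) / (3 ^ 13 * 5 ^ 8 * 11 ^ 3 * 53 * 73 ^ 2 * 89 ^ 2 * 103 : ℕ))) l)
    (hloc : letI := T.instFieldF; letI := T.instNumberFieldF; letI := T.instAlgebraF; letI := T.instFieldK
      letI := T.instNumberFieldK; letI := T.instAlgebraK; letI := T.instFieldFbar; letI := T.instAlgebraFbar
      letI := T.instAlgebraKFbar; letI := T.instIsElliptic
      haveI : Fact (Nat.Prime 4229) := ⟨by norm_num⟩
      ∀ x₀ : (thetaIndex (pilotDataOfK T.D T.K)).Fibre (.inr ⟨4229, by norm_num⟩),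
        absRamificationIdx 4229 (kOf (pilotDataOfK T.D T.K) 4229 x₀) ∣ 5 * l) :
    letI := T.instFieldF; letI := T.instNumberFieldF; letI := T.instAlgebraF; letI := T.instFieldK
    letI := T.instNumberFieldK; letI := T.instAlgebraK; letI := T.instFieldFbar; letI := T.instAlgebraFbar
    letI := T.instAlgebraKFbar; letI := T.instIsElliptic
    ∀ {logv : PadicLogs T.K} (hlog : LogvAnalytic logv) (M : Type) [Field M] [NumberField M]
      (archPk : ∀ (j : (thetaIndex (pilotDataOfK T.D T.K)).Label) (vQ : (thetaIndex (pilotDataOfK T.D T.K)).VQ),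
        Set ((logShellsDH (pilotDataOfK T.D T.K) logv).Packet j vQ))
      (archSub : ∀ (j : (thetaIndex (pilotDataOfK T.D T.K)).Label) (v : (thetaIndex (pilotDataOfK T.D T.K)).V),
        Set ((logShellsDH (pilotDataOfK T.D T.K) logv).Packet j ((thetaIndex (pilotDataOfK T.D T.K)).over v)))
      (Ψ : ℤ → ∀ v : (thetaIndex (pilotDataOfK T.D T.K)).V, v ∈ (thetaIndex (pilotDataOfK T.D T.K)).Vbad →
        Set ((logShellsDH (pilotDataOfK T.D T.K) logv).StarPacket v))
      (act : ℤ → ∀ v : (thetaIndex (pilotDataOfK T.D T.K)).V, v ∈ (thetaIndex (pilotDataOfK T.D T.K)).Vbad →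
        (logShellsDH (pilotDataOfK T.D T.K) logv).StarPacket v → Module.End ℚ ((logShellsDH (pilotDataOfK T.D T.K) logv).StarPacket v))
      (Mmod : ℤ → ∀ j : (thetaIndex (pilotDataOfK T.D T.K)).LabelStar, Set ((logShellsDH (pilotDataOfK T.D T.K) logv).GlobalPacket j.1))
      (region : ℤ → ∀ j : (thetaIndex (pilotDataOfK T.D T.K)).LabelStar, FinDivisor M → ∀ vQ : (thetaIndex (pilotDataOfK T.D T.K)).VQ,
        Set ((logShellsDH (pilotDataOfK T.D T.K) logv).Packet j.1 vQ))
      (n : ℤ) {HT : Type} {LogLink : HT → HT → Type} {IsFull : ∀ {s t : HT}, LogLink s t → Prop}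
      (lat : LGPGaussianLogThetaLattice LogLink IsFull)
      {Frd : Type} {IsoF : Frd → Frd → Type} {Ob : Frd → Type} {realify : Frd → Frd} {Strip : Type}
      {IsoS : Strip → Strip → Type} {Mv : ∀ v : (thetaIndex (pilotDataOfK T.D T.K)).V, v ∈ (thetaIndex (pilotDataOfK T.D T.K)).Vbad → Type}
      [∀ v h, Monoid (Mv v h)]
      (sig : GlobalLGPFrobenioidSignature (thetaIndex (pilotDataOfK T.D T.K)).lstar (thetaIndex (pilotDataOfK T.D T.K)).V
        (· ∈ (thetaIndex (pilotDataOfK T.D T.K)).Vbad) Frd IsoF Ob realify Strip IsoS Mv)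
      (split : SplittingMonoids Mv) {ObΔ : Type} {N : ∀ v : (thetaIndex (pilotDataOfK T.D T.K)).V, v ∈ (thetaIndex (pilotDataOfK T.D T.K)).Vbad → Type}
      [∀ v h, Monoid (N v h)] (qData : QPilotData ObΔ N)
      (tq : ∀ (pp : Nat.Primes) (x : (thetaIndex (pilotDataOfK T.D T.K)).Fibre (.inr pp)),
        haveI : Fact (pp : ℕ).Prime := ⟨pp.2⟩; kOf (pilotDataOfK T.D T.K) pp.1 x)
      (t : ∀ (pp : Nat.Primes) (_ : Fin (pilotDataOfK T.D T.K).lstar) (x : (thetaIndex (pilotDataOfK T.D T.K)).Fibre (.inr pp)),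
        haveI : Fact (pp : ℕ).Prime := ⟨pp.2⟩; kOf (pilotDataOfK T.D T.K) pp.1 x)
      (htq0 : ∀ pp x, tq pp x ≠ 0)
      (htq1 : ∀ (pp : Nat.Primes) (x : (thetaIndex (pilotDataOfK T.D T.K)).Fibre (.inr pp)),
        haveI : Fact (pp : ℕ).Prime := ⟨pp.2⟩; placeOf (pilotDataOfK T.D T.K) pp.1 x ∉ (pilotDataOfK T.D T.K).S → ‖tq pp x‖ = 1)
      (_ht0 : ∀ pp i x, t pp i x ≠ 0)
      (_ht : ∀ (pp : Nat.Primes) (i : Fin (pilotDataOfK T.D T.K).lstar) (x : (thetaIndex (pilotDataOfK T.D T.K)).Fibre (.inr pp)),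
        haveI : Fact (pp : ℕ).Prime := ⟨pp.2⟩
        Real.log ‖t pp i x‖ = -((pilotDataOfK T.D T.K).thetaPilot i (placeOf (pilotDataOfK T.D T.K) pp.1 x)) *
          logNorm T.K (placeOf (pilotDataOfK T.D T.K) pp.1 x) / localDegree T.K (placeOf (pilotDataOfK T.D T.K) pp.1 x))
      (_htq : ∀ (pp : Nat.Primes) (x : (thetaIndex (pilotDataOfK T.D T.K)).Fibre (.inr pp)),
        haveI : Fact (pp : ℕ).Prime := ⟨pp.2⟩
        Real.log ‖tq pp x‖ = -((pilotDataOfK T.D T.K).qPilot (placeOf (pilotDataOfK T.D T.K) pp.1 x)) *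
          logNorm T.K (placeOf (pilotDataOfK T.D T.K) pp.1 x) / localDegree T.K (placeOf (pilotDataOfK T.D T.K) pp.1 x)),
      ¬ Thm311ToCor312.Licence
        (settingPrVolSharp (pilotDataOfK T.D T.K) hlog M archPk archSub Ψ act Mmod region n lat sig split qData tq t htq0 htq1) := by
  letI := T.instFieldF; letI := T.instNumberFieldF; letI := T.instAlgebraF; letI := T.instFieldK
  letI := T.instNumberFieldK; letI := T.instAlgebraK; letI := T.instFieldFbar; letI := T.instAlgebraFbar
  letI := T.instAlgebraKFbar; letI := T.instIsElliptic
  intro logv hlog M _ _ archPk archSub Ψ act Mmod region n HT LogLink IsFull lat Frd IsoF Ob realify Strip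
    IsoS Mv _ sig split ObΔ N _ qData tq t htq0 htq1 ht0 ht htq
  have hp : Nat.Prime 4229 := by norm_num
  have hodd : Odd l := hl.odd_of_ne_two (by omega)
  have hfac : (7 ^ 5 * 61 * (2 ^ 13 * 13 ^ 7 * 17 ^ 3 * 4229 ^ 3) * (3 ^ 13 * 5 ^ 8 * 11 ^ 3 * 53 * 73 ^ 2 * 89 ^ 2 * 103)).factorization ((⟨4229, hp⟩ : Nat.Primes) : ℕ) = 3 := by
    have hn : 7 ^ 5 * 61 * (2 ^ 13 * 13 ^ 7 * 17 ^ 3 * 4229 ^ 3) * (3 ^ 13 * 5 ^ 8 * 11 ^ 3 * 53 * 73 ^ 2 * 89 ^ 2 * 103) = 4229 ^ 3 * 494553680606537285451691336152788401603200000000 := by norm_num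
    have hm : ¬ 4229 ∣ 494553680606537285451691336152788401603200000000 := by norm_num
    show (7 ^ 5 * 61 * (2 ^ 13 * 13 ^ 7 * 17 ^ 3 * 4229 ^ 3) * (3 ^ 13 * 5 ^ 8 * 11 ^ 3 * 53 * 73 ^ 2 * 89 ^ 2 * 103)).factorization 4229 = 3
    rw [hn, Nat.factorization_mul (pow_ne_zero _ hp.ne_zero) (by norm_num), Finsupp.add_apply, hp.factorization_pow,
      Finsupp.single_eq_same, Nat.factorization_eq_zero_of_not_dvd hm, add_zero]
  -- the sub-class `e ∣ 5·l` is the exact type `e = 5·l` (class lemma)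
  have hloc' : letI := T.instFieldF; letI := T.instNumberFieldF; letI := T.instAlgebraF; letI := T.instFieldK
      letI := T.instNumberFieldK; letI := T.instAlgebraK; letI := T.instFieldFbar; letI := T.instAlgebraFbar
      letI := T.instAlgebraKFbar; letI := T.instIsElliptic
      haveI : Fact (Nat.Prime 4229) := ⟨hp⟩
      ∀ x₀ : (thetaIndex (pilotDataOfK T.D T.K)).Fibre (.inr ⟨4229, hp⟩),
        absRamificationIdx 4229 (kOf (pilotDataOfK T.D T.K) 4229 x₀) = 5 * l := by
    intro x₀
    obtain ⟨A, hA, hA30, hA15, hAev, hA3, hA5, -⟩ := WRow.localType_class_triple_sharp isABCTriple_4229 T ⟨4229, hp⟩ (by norm_num) (by norm_num)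
      (by norm_num) (show (4229 : ℕ) ≠ l by omega) (by norm_num) hfac x₀
    have hdiv : A * l ∣ 5 * l := hA ▸ hloc x₀
    have hAd : A ∣ 5 := Nat.dvd_of_mul_dvd_mul_right (by omega) hdiv
    have hAeq : A = 5 := by
      have hA31 : A ≤ 30 := Nat.le_of_dvd (by norm_num) hA30
      interval_cases A <;> omega
    rw [hA, hAeq]
  have hP : 5 * l * (7 ^ 5 * 61 * (2 ^ 13 * 13 ^ 7 * 17 ^ 3 * 4229 ^ 3) * (3 ^ 13 * 5 ^ 8 * 11 ^ 3 * 53 * 73 ^ 2 * 89 ^ 2 * 103)).factorization ((⟨4229, hp⟩ : Nat.Primes) : ℕ) = l * (5 * 3) := by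
    rw [hfac]; ring
  clear hfac
  have hpe : ¬ (4229 : ℕ) ∣ 5 * l := by
    intro h
    rcases (Nat.Prime.dvd_mul hp).mp h with h1 | h1
    · revert h1; norm_num
    · exact hne ((Nat.prime_dvd_prime_iff_eq hp hl).mp h1).symm
  obtain ⟨a₀, h1, h2, h3⟩ := RefBand.typecells_1025227_five hlo hhi hodd (i := (l - 1) / 2 - 1) (by omega)
  exact WRow.not_licence_triple_of_not_hullCell isABCTriple_4229 T ⟨4229, hp⟩ (by norm_num) (show (4229 : ℕ) ≠ l by omega)
    (by norm_num) (e₀ := 5 * l) (P := 5 * 3) (i := (l - 1) / 2 - 1) (a₀ := a₀) hpe hloc' hP (by omega) h1 h2 h3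
    hlog M archPk archSub Ψ act Mmod region n lat sig split qData tq t htq0 htq1 ht0 ht htq

/-- **PER-TYPE REF band in the W-lane row shape** (chosen realising ideles, pinned reading, every free binder): the triple `7 ^ 5 * 61 + 2 ^ 13 * 13 ^ 7 * 17 ^ 3 * 4229 ^ 3 = 3 ^ 13 * 5 ^ 8 * 11 ^ 3 * 53 * 73 ^ 2 * 89 ^ 2 * 103`,
sub-class `e(·∣4229) ∣ 5·l`, every prime `9 ≤ l ≤ 1681`, `l ≠ 4229` ⇒ `¬ Cor312Vol.PilotKummerCompatHull …`.
[cite: Mochizuki2012, IUTchIII Cor. 3.12 Step (xi-f) p. 184] [claim: Mochizuki2012, status: disputed] -/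
theorem GenuineK.not_pilotKummerCompatHull_chosen_triple_1025227_typeband_of_five {l : ℕ} (hl : l.Prime) (hlo : 9 ≤ l) (hhi : l ≤ 1681)
    (hne : l ≠ 4229) (T : Cor22.ThetaVolumeDatumAt (ratPoint (((7 ^ 5 * 61 : ℕ) : ℚ) / (3 ^ 13 * 5 ^ 8 * 11 ^ 3 * 53 * 73 ^ 2 * 89 ^ 2 * 103 : ℕ))) l)
    (hloc : letI := T.instFieldF; letI := T.instNumberFieldF; letI := T.instAlgebraF; letI := T.instFieldK
      letI := T.instNumberFieldK; letI := T.instAlgebraK; letI := T.instFieldFbar; letI := T.instAlgebraFbar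
      letI := T.instAlgebraKFbar; letI := T.instIsElliptic
      haveI : Fact (Nat.Prime 4229) := ⟨by norm_num⟩
      ∀ x₀ : (thetaIndex (pilotDataOfK T.D T.K)).Fibre (.inr ⟨4229, by norm_num⟩),
        absRamificationIdx 4229 (kOf (pilotDataOfK T.D T.K) 4229 x₀) ∣ 5 * l) :
    letI := T.instFieldF; letI := T.instNumberFieldF; letI := T.instAlgebraF; letI := T.instFieldK
    letI := T.instNumberFieldK; letI := T.instAlgebraK; letI := T.instFieldFbar; letI := T.instAlgebraFbar
    letI := T.instAlgebraKFbar; letI := T.instIsElliptic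
    ∀ (M : Type) [Field M] [NumberField M]
      (archPk : ∀ (j : (thetaIndex (pilotDataOfK T.D T.K)).Label) (vQ : (thetaIndex (pilotDataOfK T.D T.K)).VQ),
        Set ((logShellsDH (pilotDataOfK T.D T.K) (analyticLogv T.K)).Packet j vQ))
      (archSub : ∀ (j : (thetaIndex (pilotDataOfK T.D T.K)).Label) (v : (thetaIndex (pilotDataOfK T.D T.K)).V),
        Set ((logShellsDH (pilotDataOfK T.D T.K) (analyticLogv T.K)).Packet j ((thetaIndex (pilotDataOfK T.D T.K)).over v)))
      (Ψ : ℤ → ∀ v : (thetaIndex (pilotDataOfK T.D T.K)).V, v ∈ (thetaIndex (pilotDataOfK T.D T.K)).Vbad →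
        Set ((logShellsDH (pilotDataOfK T.D T.K) (analyticLogv T.K)).StarPacket v))
      (act : ℤ → ∀ v : (thetaIndex (pilotDataOfK T.D T.K)).V, v ∈ (thetaIndex (pilotDataOfK T.D T.K)).Vbad →
        (logShellsDH (pilotDataOfK T.D T.K) (analyticLogv T.K)).StarPacket v →
          Module.End ℚ ((logShellsDH (pilotDataOfK T.D T.K) (analyticLogv T.K)).StarPacket v))
      (Mmod : ℤ → ∀ j : (thetaIndex (pilotDataOfK T.D T.K)).LabelStar,
        Set ((logShellsDH (pilotDataOfK T.D T.K) (analyticLogv T.K)).GlobalPacket j.1))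
      (region : ℤ → ∀ j : (thetaIndex (pilotDataOfK T.D T.K)).LabelStar, FinDivisor M →
        ∀ vQ : (thetaIndex (pilotDataOfK T.D T.K)).VQ, Set ((logShellsDH (pilotDataOfK T.D T.K) (analyticLogv T.K)).Packet j.1 vQ))
      (frobAdm : ℤ → ℤ → ∀ (j : (thetaIndex (pilotDataOfK T.D T.K)).Label) (vQ : (thetaIndex (pilotDataOfK T.D T.K)).VQ),
        Set ((logShellsDH (pilotDataOfK T.D T.K) (analyticLogv T.K)).Packet j vQ) → Prop)
      (frobLogvol : ℤ → ℤ → ∀ (j : (thetaIndex (pilotDataOfK T.D T.K)).Label) (vQ : (thetaIndex (pilotDataOfK T.D T.K)).VQ),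
        Set ((logShellsDH (pilotDataOfK T.D T.K) (analyticLogv T.K)).Packet j vQ) → ℝ)
      (frobΨ : ℤ → ℤ → ∀ v : (thetaIndex (pilotDataOfK T.D T.K)).V, v ∈ (thetaIndex (pilotDataOfK T.D T.K)).Vbad →
        Set ((logShellsDH (pilotDataOfK T.D T.K) (analyticLogv T.K)).StarPacket v))
      (frobMmod : ℤ → ℤ → ∀ j : (thetaIndex (pilotDataOfK T.D T.K)).LabelStar,
        Set ((logShellsDH (pilotDataOfK T.D T.K) (analyticLogv T.K)).GlobalPacket j.1))
      (unitImage : ℤ → ℤ → ℕ → ∀ (j : (thetaIndex (pilotDataOfK T.D T.K)).Label) (vQ : (thetaIndex (pilotDataOfK T.D T.K)).VQ),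
        Set ((logShellsDH (pilotDataOfK T.D T.K) (analyticLogv T.K)).Packet j vQ))
      (ballImage : ℤ → ℤ → ∀ (j : (thetaIndex (pilotDataOfK T.D T.K)).Label) (vQ : (thetaIndex (pilotDataOfK T.D T.K)).VQ),
        Set ((logShellsDH (pilotDataOfK T.D T.K) (analyticLogv T.K)).Packet j vQ))
      (thetaDiv : ℤ → ℤ → LgpDivisor M (thetaIndex (pilotDataOfK T.D T.K)).lstar)
      (n : ℤ) {HT : Type} {LogLink : HT → HT → Type} {IsFull : ∀ {s t : HT}, LogLink s t → Prop}
      (lat : LGPGaussianLogThetaLattice LogLink IsFull)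
      {Frd : Type} {IsoF : Frd → Frd → Type} {Ob : Frd → Type} {realify : Frd → Frd} {Strip : Type}
      {IsoS : Strip → Strip → Type} {Mv : ∀ v : (thetaIndex (pilotDataOfK T.D T.K)).V, v ∈ (thetaIndex (pilotDataOfK T.D T.K)).Vbad → Type}
      [∀ v h, Monoid (Mv v h)]
      (sig : GlobalLGPFrobenioidSignature (thetaIndex (pilotDataOfK T.D T.K)).lstar (thetaIndex (pilotDataOfK T.D T.K)).V
        (· ∈ (thetaIndex (pilotDataOfK T.D T.K)).Vbad) Frd IsoF Ob realify Strip IsoS Mv)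
      (split : SplittingMonoids Mv) {ObΔ : Type}
      {N : ∀ v : (thetaIndex (pilotDataOfK T.D T.K)).V, v ∈ (thetaIndex (pilotDataOfK T.D T.K)).Vbad → Type}
      [∀ v h, Monoid (N v h)] (qData : QPilotData ObΔ N)
      (qK : ∀ v : (thetaIndex (pilotDataOfK T.D T.K)).V, v ∈ (thetaIndex (pilotDataOfK T.D T.K)).Vbad →
        Set ((logShellsDH (pilotDataOfK T.D T.K) (analyticLogv T.K)).StarPacket v)),
    ¬ Cor312Vol.PilotKummerCompatHull
        (LatticeSituation.ofShells (logShellsDH (pilotDataOfK T.D T.K) (analyticLogv T.K)) M archPk archSub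
          (summandPiecesPr (pilotDataOfK T.D T.K) (logvAnalytic_analyticLogv (F := T.K))).Adm
          (summandPiecesPr (pilotDataOfK T.D T.K) (logvAnalytic_analyticLogv (F := T.K))).logvol Ψ act Mmod region frobAdm
          frobLogvol frobΨ frobMmod unitImage ballImage thetaDiv)
        (settingPrVolSharp (pilotDataOfK T.D T.K) (logvAnalytic_analyticLogv (F := T.K)) M archPk archSub Ψ act Mmod region n
          lat sig split qData (exists_realising_qIdeles_pilotDataOfK T.D).choose (exists_realising_thetaIdeles_pilotDataOfK T.D).choose
          (exists_realising_qIdeles_pilotDataOfK T.D).choose_spec.1 (exists_realising_qIdeles_pilotDataOfK T.D).choose_spec.2.1)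
        (fun _ => Cor312.Setting.qRegion
          (settingPrVolSharp (pilotDataOfK T.D T.K) (logvAnalytic_analyticLogv (F := T.K)) M archPk archSub Ψ act Mmod region n
            lat sig split qData (exists_realising_qIdeles_pilotDataOfK T.D).choose (exists_realising_thetaIdeles_pilotDataOfK T.D).choose
            (exists_realising_qIdeles_pilotDataOfK T.D).choose_spec.1 (exists_realising_qIdeles_pilotDataOfK T.D).choose_spec.2.1))
        qK := by
  letI := T.instFieldF; letI := T.instNumberFieldF; letI := T.instAlgebraF; letI := T.instFieldK
  letI := T.instNumberFieldK; letI := T.instAlgebraK; letI := T.instFieldFbar; letI := T.instAlgebraFbar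
  letI := T.instAlgebraKFbar; letI := T.instIsElliptic
  intro M _ _ archPk archSub Ψ act Mmod region frobAdm frobLogvol frobΨ frobMmod
    unitImage ballImage thetaDiv n HT LogLink IsFull lat Frd IsoF Ob realify Strip IsoS Mv _ sig split ObΔ N _ qData qK hSH
  have hL := licence_of_pilotKummerCompatHull (hq := fun _ _ => rfl) (hc := hSH)
  exact WRow.not_licence_triple_1025227_typeband_of_five hl hlo hhi hne T hloc (logvAnalytic_analyticLogv (F := T.K)) M archPk archSub Ψ act Mmod
    region n lat sig split qData (exists_realising_qIdeles_pilotDataOfK T.D).choose (exists_realising_thetaIdeles_pilotDataOfK T.D).choose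
    (exists_realising_qIdeles_pilotDataOfK T.D).choose_spec.1 (exists_realising_qIdeles_pilotDataOfK T.D).choose_spec.2.1
    (exists_realising_thetaIdeles_pilotDataOfK T.D).choose_spec.1 (exists_realising_thetaIdeles_pilotDataOfK T.D).choose_spec.2.2
    (exists_realising_qIdeles_pilotDataOfK T.D).choose_spec.2.2 hL

end Summit.ABC.IUTFork.Conditional

end
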